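import Summits.Ventures.PercRepro.S1CoreCapEightFour

/-!
# PercRepro — TOWARDS `Q*(8)`: FOUR BIG LINES WITHOUT A TRIANGLE — THE COST FACTS (p1, gen 27)

The first third of the no-triangle half of `FourBigBound₈`. Four simple 4-point lines `M₁, …, M₄` and a
fat-free 3-point line `X` of the configuration: placing `X` first, the ordering costs
`1 + Σ_i (4 − max old_i 2) ≤ 8`, and `old₁ ≤ 1`, `old₂ ≤ 2`, so the third or the fourth line meets `X` and the
earlier lines in `≥ 3` points (`cost_X_first`). Consequences: if no two of the big lines meet, no such `X` exists
(`no_transversal_of_disjoint`, which needs only that `L₃, L₄` miss the earlier lines); and if `A` meets `B` while no three big lines pairwise meet in distinct points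
(`NoTriangle`: for all big `M, N, O`, `N ∩ M = ∅` or `|O ∩ (N ∪ M)| ≤ 1`), the four orderings
`A, B, C, D` / `A, B, D, C` / `C, D, A, B` / `C, D, B, A` give the eight facts `|D ∩ C| = 1`,
`|C ∩ (B ∪ A)| = |D ∩ (B ∪ A)| = |A ∩ (D ∪ C)| = |B ∩ (D ∪ C)| = 1` and `|X ∩ M| = 1` for every big `M`
(`meets_all_of_meet`) — from which `proofs/P1-S4-CAPBRIDGE.md` §19 ADDENDUM 2 derives the 4-cycle and the
contradiction (the remaining two thirds, not typed here). Axioms: standard.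
-/

namespace PercRepro

namespace S1

namespace FourCap

namespace Eight

open Seven

variable {β : Type} [DecidableEq β]

section NoTriangle

variable {w : β → ℕ} {ls : Finset (Finset β)}
  (h1 : ∀ L ∈ ls, ∀ v ∈ L, w v = 1 ∨ w v = 2)
  (h2 : ∀ L ∈ ls, 3 ≤ L.card ∧ wsum w L ≤ 5)
  (h3 : ∀ L ∈ ls, ∀ L' ∈ ls, L ≠ L' → (L ∩ L').card ≤ 1)
  (h4 : ∀ l : List (Finset β), l.Nodup → (∀ L ∈ l, L ∈ ls) → wsum w (unionL l) ≤ 8 + lineRank l)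

include h1 h2 h3 h4 in
/-- **The cost of four big lines after a 3-point line**: with `X` placed first, the third or the fourth big
line meets `X` and the earlier big lines in at least three points. -/
theorem cost_X_first {X M₁ M₂ M₃ M₄ : Finset β} (hX : X ∈ ls) (hM₁ : M₁ ∈ ls) (hM₂ : M₂ ∈ ls) (hM₃ : M₃ ∈ ls)
    (hM₄ : M₄ ∈ ls) (h1X : M₁ ≠ X) (h2X : M₂ ≠ X) (h3X : M₃ ≠ X) (h4X : M₄ ≠ X) (h21 : M₂ ≠ M₁)
    (h31 : M₃ ≠ M₁) (h41 : M₄ ≠ M₁) (h32 : M₃ ≠ M₂) (h42 : M₄ ≠ M₂) (h43 : M₄ ≠ M₃)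
    (cX : X.card = 3) (fX : fat w X = 0) (c1 : M₁.card = 4) (c2 : M₂.card = 4) (c3 : M₃.card = 4)
    (c4 : M₄.card = 4) (f1 : fat w M₁ = 0) (f2 : fat w M₂ = 0) :
    3 ≤ (M₃ ∩ (M₂ ∪ (M₁ ∪ X))).card ∨ 3 ≤ (M₄ ∩ (M₃ ∪ (M₂ ∪ (M₁ ∪ X)))).card := by
  have hc := costSum_le h1 (two_le_card_of_spec h2) h4 [M₄, M₃, M₂, M₁, X]
    (by simp [h1X, h2X, h3X, h4X, h21, h31, h41, h32, h42, h43]) (by simp [hX, hM₁, hM₂, hM₃, hM₄])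
  simp only [costSum, unionL, Finset.union_empty, Nat.zero_add] at hc
  have e0 := lineCost_empty w X
  have e1 := lineCost_of_inter_le_two (w := w) (le_trans (h3 M₁ hM₁ X hX h1X) (by omega))
  have e2 := lineCost_of_inter_le_two (w := w) (le_trans (card_inter_union_le M₂ M₁ X)
    (by have := h3 M₂ hM₂ M₁ hM₁ h21; have := h3 M₂ hM₂ X hX h2X; omega))
  have e3 := lineCost_ge (w := w) M₃ (M₂ ∪ (M₁ ∪ X))
  have e4 := lineCost_ge (w := w) M₄ (M₃ ∪ (M₂ ∪ (M₁ ∪ X)))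
  have g1 : fat w (M₁ \ X) ≤ 0 := le_trans (fat_mono w Finset.sdiff_subset) f1.le
  have g2 : fat w (M₂ \ (M₁ ∪ X)) ≤ 0 := le_trans (fat_mono w Finset.sdiff_subset) f2.le
  have i3 : (M₃ ∩ (M₂ ∪ (M₁ ∪ X))).card ≤ 3 := le_trans (card_inter_union_le M₃ M₂ (M₁ ∪ X))
    (le_trans (Nat.add_le_add_left (card_inter_union_le M₃ M₁ X) _)
      (by have := h3 M₃ hM₃ M₂ hM₂ h32; have := h3 M₃ hM₃ M₁ hM₁ h31; have := h3 M₃ hM₃ X hX h3X; omega))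
  omega

include h1 h2 h3 h4 in
/-- **Pairwise disjoint big lines admit no 3-point line inside their union**: `old₃ ≤ 1` and `old₄ ≤ 1`. -/
theorem no_transversal_of_disjoint {X L₁ L₂ L₃ L₄ : Finset β} (hX : X ∈ ls) (hL₁ : L₁ ∈ ls) (hL₂ : L₂ ∈ ls)
    (hL₃ : L₃ ∈ ls) (hL₄ : L₄ ∈ ls) (h1X : L₁ ≠ X) (h2X : L₂ ≠ X) (h3X : L₃ ≠ X) (h4X : L₄ ≠ X)
    (h21 : L₂ ≠ L₁) (h31 : L₃ ≠ L₁) (h41 : L₄ ≠ L₁) (h32 : L₃ ≠ L₂) (h42 : L₄ ≠ L₂) (h43 : L₄ ≠ L₃)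
    (cX : X.card = 3) (fX : fat w X = 0) (c1 : L₁.card = 4) (c2 : L₂.card = 4) (c3 : L₃.card = 4)
    (c4 : L₄.card = 4) (f1 : fat w L₁ = 0) (f2 : fat w L₂ = 0)
    (d31 : (L₃ ∩ L₁).card = 0) (d41 : (L₄ ∩ L₁).card = 0)
    (d32 : (L₃ ∩ L₂).card = 0) (d42 : (L₄ ∩ L₂).card = 0) (d43 : (L₄ ∩ L₃).card = 0) : False := by
  have h := cost_X_first h1 h2 h3 h4 hX hL₁ hL₂ hL₃ hL₄ h1X h2X h3X h4X h21 h31 h41 h32 h42 h43 cX fX c1 c2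
    c3 c4 f1 f2
  have i3 : (L₃ ∩ (L₂ ∪ (L₁ ∪ X))).card ≤ (L₃ ∩ L₂).card + ((L₃ ∩ L₁).card + (L₃ ∩ X).card) :=
    le_trans (card_inter_union_le L₃ L₂ (L₁ ∪ X)) (Nat.add_le_add_left (card_inter_union_le L₃ L₁ X) _)
  have i4 : (L₄ ∩ (L₃ ∪ (L₂ ∪ (L₁ ∪ X)))).card ≤
      (L₄ ∩ L₃).card + ((L₄ ∩ L₂).card + ((L₄ ∩ L₁).card + (L₄ ∩ X).card)) :=
    le_trans (card_inter_union_le L₄ L₃ (L₂ ∪ (L₁ ∪ X)))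
      (Nat.add_le_add_left (le_trans (card_inter_union_le L₄ L₂ (L₁ ∪ X))
        (Nat.add_le_add_left (card_inter_union_le L₄ L₁ X) _)) _)
  have := h3 L₃ hL₃ X hX h3X
  have := h3 L₄ hL₄ X hX h4X
  omega

/-- **No triangle among the big lines**: no three lines of `≥ 4` points pairwise meet in distinct points — in
the order-free form «`N ∩ M = ∅` or `O` meets `N ∪ M` in at most one point» for all big `M, N, O`. -/
def NoTriangle (ls : Finset (Finset β)) : Prop :=
  ∀ M N O : Finset β, M ∈ ls → N ∈ ls → O ∈ ls → 4 ≤ M.card → 4 ≤ N.card → 4 ≤ O.card → N ≠ M → O ≠ M → O ≠ N →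
    (N ∩ M).card = 0 ∨ (O ∩ (N ∪ M)).card ≤ 1

include h1 h2 h3 h4 in
/-- **One meeting pair and no triangle force everything else**: with `|B ∩ A| = 1`, the four orderings
`A, B, C, D` / `A, B, D, C` / `C, D, A, B` / `C, D, B, A` after `X` give `|D ∩ C| = 1`, `C` and `D` meet `A ∪ B`
in exactly one point, `A` and `B` meet `C ∪ D` in exactly one point, and `X` meets each big line in one point. -/
theorem meets_all_of_meet (hnt : NoTriangle ls) {X A B C D : Finset β} (hX : X ∈ ls) (hA : A ∈ ls)
    (hB : B ∈ ls) (hC : C ∈ ls) (hD : D ∈ ls) (hAX : A ≠ X) (hBX : B ≠ X) (hCX : C ≠ X) (hDX : D ≠ X)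
    (hBA : B ≠ A) (hCA : C ≠ A) (hDA : D ≠ A) (hCB : C ≠ B) (hDB : D ≠ B) (hDC : D ≠ C)
    (cX : X.card = 3) (fX : fat w X = 0) (cA : A.card = 4) (cB : B.card = 4) (cC : C.card = 4)
    (cD : D.card = 4) (fA : fat w A = 0) (fB : fat w B = 0) (fC : fat w C = 0) (fD : fat w D = 0)
    (hmeet : (B ∩ A).card = 1) :
    (D ∩ C).card = 1 ∧ (C ∩ (B ∪ A)).card = 1 ∧ (D ∩ (B ∪ A)).card = 1 ∧ (A ∩ (D ∪ C)).card = 1 ∧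
      (B ∩ (D ∪ C)).card = 1 ∧ (X ∩ A).card = 1 ∧ (X ∩ B).card = 1 ∧ (X ∩ C).card = 1 ∧ (X ∩ D).card = 1 := by
  -- pairwise bounds
  have pCX := h3 C hC X hX hCX
  have pDX := h3 D hD X hX hDX
  have pAX := h3 A hA X hX hAX
  have pBX := h3 B hB X hX hBX
  have pDC := h3 D hD C hC hDC
  have pBA := h3 B hB A hA hBA
  have iAX : (A ∩ X).card = (X ∩ A).card := by rw [Finset.inter_comm]
  have iBX : (B ∩ X).card = (X ∩ B).card := by rw [Finset.inter_comm]
  have iCX : (C ∩ X).card = (X ∩ C).card := by rw [Finset.inter_comm]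
  have iDX : (D ∩ X).card = (X ∩ D).card := by rw [Finset.inter_comm]
  -- no triangle on `(A, B, ·)`: `C` and `D` meet `A ∪ B` in at most one point
  have tC : (C ∩ (B ∪ A)).card ≤ 1 := by
    rcases hnt A B C hA hB hC (by omega) (by omega) (by omega) hBA hCA hCB with h | h
    · omega
    · exact h
  have tD : (D ∩ (B ∪ A)).card ≤ 1 := by
    rcases hnt A B D hA hB hD (by omega) (by omega) (by omega) hBA hDA hDB with h | h
    · omega
    · exact h
  -- the ordering `A, B, C, D`
  have o1 := cost_X_first h1 h2 h3 h4 hX hA hB hC hD hAX hBX hCX hDX hBA hCA hDA hCB hDB hDC cX fX cA cB cC cD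
    fA fB
  have j3 : (C ∩ (B ∪ (A ∪ X))).card ≤ (C ∩ (B ∪ A)).card + (C ∩ X).card := by
    have e : C ∩ (B ∪ (A ∪ X)) = C ∩ ((B ∪ A) ∪ X) := by congr 1; ac_rfl
    rw [e]; exact card_inter_union_le C (B ∪ A) X
  have j4 : (D ∩ (C ∪ (B ∪ (A ∪ X)))).card ≤ (D ∩ C).card + ((D ∩ (B ∪ A)).card + (D ∩ X).card) := by
    have e : D ∩ (C ∪ (B ∪ (A ∪ X))) = D ∩ (C ∪ ((B ∪ A) ∪ X)) := by congr 1; ac_rfl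
    rw [e]
    exact le_trans (card_inter_union_le D C ((B ∪ A) ∪ X)) (Nat.add_le_add_left (card_inter_union_le D (B ∪ A) X) _)
  have r1 : (D ∩ C).card = 1 ∧ (D ∩ (B ∪ A)).card = 1 ∧ (D ∩ X).card = 1 := by omega
  -- the ordering `A, B, D, C`
  have o2 := cost_X_first h1 h2 h3 h4 hX hA hB hD hC hAX hBX hDX hCX hBA hDA hCA hDB hCB hDC.symm cX fX cA cB
    cD cC fA fB
  have j3' : (D ∩ (B ∪ (A ∪ X))).card ≤ (D ∩ (B ∪ A)).card + (D ∩ X).card := by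
    have e : D ∩ (B ∪ (A ∪ X)) = D ∩ ((B ∪ A) ∪ X) := by congr 1; ac_rfl
    rw [e]; exact card_inter_union_le D (B ∪ A) X
  have j4' : (C ∩ (D ∪ (B ∪ (A ∪ X)))).card ≤ (C ∩ D).card + ((C ∩ (B ∪ A)).card + (C ∩ X).card) := by
    have e : C ∩ (D ∪ (B ∪ (A ∪ X))) = C ∩ (D ∪ ((B ∪ A) ∪ X)) := by congr 1; ac_rfl
    rw [e]
    exact le_trans (card_inter_union_le C D ((B ∪ A) ∪ X)) (Nat.add_le_add_left (card_inter_union_le C (B ∪ A) X) _)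
  have pCD := h3 C hC D hD hDC.symm
  have r2 : (C ∩ (B ∪ A)).card = 1 ∧ (C ∩ X).card = 1 := by omega
  -- no triangle on `(C, D, ·)`: `A` and `B` meet `C ∪ D` in at most one point
  have tA : (A ∩ (D ∪ C)).card ≤ 1 := by
    rcases hnt C D A hC hD hA (by omega) (by omega) (by omega) hDC hCA.symm hDA.symm with h | h
    · omega
    · exact h
  have tB : (B ∩ (D ∪ C)).card ≤ 1 := by
    rcases hnt C D B hC hD hB (by omega) (by omega) (by omega) hDC hCB.symm hDB.symm with h | h
    · omega
    · exact h
  -- the ordering `C, D, A, B`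
  have o3 := cost_X_first h1 h2 h3 h4 hX hC hD hA hB hCX hDX hAX hBX hDC hCA.symm hCB.symm hDA.symm hDB.symm hBA
    cX fX cC cD cA cB fC fD
  have k3 : (A ∩ (D ∪ (C ∪ X))).card ≤ (A ∩ (D ∪ C)).card + (A ∩ X).card := by
    have e : A ∩ (D ∪ (C ∪ X)) = A ∩ ((D ∪ C) ∪ X) := by congr 1; ac_rfl
    rw [e]; exact card_inter_union_le A (D ∪ C) X
  have k4 : (B ∩ (A ∪ (D ∪ (C ∪ X)))).card ≤ (B ∩ A).card + ((B ∩ (D ∪ C)).card + (B ∩ X).card) := by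
    have e : B ∩ (A ∪ (D ∪ (C ∪ X))) = B ∩ (A ∪ ((D ∪ C) ∪ X)) := by congr 1; ac_rfl
    rw [e]
    exact le_trans (card_inter_union_le B A ((D ∪ C) ∪ X)) (Nat.add_le_add_left (card_inter_union_le B (D ∪ C) X) _)
  have r3 : (B ∩ (D ∪ C)).card = 1 ∧ (B ∩ X).card = 1 := by omega
  -- the ordering `C, D, B, A`
  have o4 := cost_X_first h1 h2 h3 h4 hX hC hD hB hA hCX hDX hBX hAX hDC hCB.symm hCA.symm hDB.symm hDA.symm
    hBA.symm cX fX cC cD cB cA fC fD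
  have k3' : (B ∩ (D ∪ (C ∪ X))).card ≤ (B ∩ (D ∪ C)).card + (B ∩ X).card := by
    have e : B ∩ (D ∪ (C ∪ X)) = B ∩ ((D ∪ C) ∪ X) := by congr 1; ac_rfl
    rw [e]; exact card_inter_union_le B (D ∪ C) X
  have k4' : (A ∩ (B ∪ (D ∪ (C ∪ X)))).card ≤ (A ∩ B).card + ((A ∩ (D ∪ C)).card + (A ∩ X).card) := by
    have e : A ∩ (B ∪ (D ∪ (C ∪ X))) = A ∩ (B ∪ ((D ∪ C) ∪ X)) := by congr 1; ac_rfl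
    rw [e]
    exact le_trans (card_inter_union_le A B ((D ∪ C) ∪ X)) (Nat.add_le_add_left (card_inter_union_le A (D ∪ C) X) _)
  have pAB := h3 A hA B hB hBA.symm
  have r4 : (A ∩ (D ∪ C)).card = 1 ∧ (A ∩ X).card = 1 := by omega
  omega

end NoTriangle

end Eight

end FourCap

end S1

end PercRepro
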